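import Summits.AtomisticToContinuum.Crystallization.Theorems.ChartedPlanarOrderPairModulusSharp
import Mathlib.Analysis.Real.Pi.Bounds

/-!
# Continuation (part B) of `ChartedPlanarOrderPairModulusSharp` — lens-3 g25 (c) PairModulusSharp e02039b2 (485 l), PRE-SPLIT by hand-2 g12 for the gate's 400-line rule
(bodies byte-identical, same namespace `Summit.AtomisticToContinuum.Crystallization.Theorems.ChartedPlanarOrderPairModulusSharp`; see the module docstring of part A for the content and tags).
-/

noncomputable section

namespace Summit.AtomisticToContinuum.Crystallization.Theorems.ChartedPlanarOrderPairModulusSharp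

open Finset Metric Real
open scoped RealInnerProductSpace
open Summit.AtomisticToContinuum.Crystallization.Theorems.ChartedPlanarOrderRigidityDoor (E3)
open Summit.AtomisticToContinuum.Crystallization.Theorems.ChartedPlanarOrderDensityDichotomy (IsSep μS)
open Summit.AtomisticToContinuum.Crystallization.Theorems.ChartedPlanarOrderDoorLayered (Layered)
open Summit.AtomisticToContinuum.Crystallization.Theorems.ChartedPlanarOrderProfileSlavingLJ (pairForce layerForce incr offsetOf tube
  IsStacked gapStress)
open Summit.AtomisticToContinuum.Crystallization.Theorems.ChartedPlanarOrderLayerForceLipschitz (le_inner_offsetOf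
  norm_layerForce_sub_le_of_floor)
open Summit.AtomisticToContinuum.Crystallization.Theorems.ChartedPlanarOrderLayerFrame (norm_sq_add_smul_normal norm_sq_eq_planar_add_height)
open Summit.AtomisticToContinuum.Crystallization.Theorems.ChartedPlanarOrderStackedLayerGeometry (inner_period_combo)
open Summit.AtomisticToContinuum.Crystallization.Theorems.ChartedPlanarOrderTubeMonotoneSplit (IsPairModulus norm_offsetOf_sub_le)
open Summit.AtomisticToContinuum.Crystallization.Theorems.ChartedPlanarOrderPairModulus (modulus modulus_nonneg pairForce_sub_le_modulus gram_pos
  qA qB exists_planar summable_layer spanConst spanConst_nonneg isPairModulus_of_heightFloor)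
open Summit.AtomisticToContinuum.Crystallization.Theorems.ChartedPlanarOrderTubeConvex (TubeConvexRef)
open Summit.AtomisticToContinuum.Crystallization.Theorems.ChartedPlanarOrderTubeChannelsRef (AdjacentChannelRef FarChannelBelowRef
  PairModulusTailRef tubeConvexRef_record_of_leaves TubeChannelsRef tubeConvexRef_record_of_channels)
open Summit.AtomisticToContinuum.Crystallization.Theorems.ChartedPlanarOrderTubeChannels (tubeChannelData_of_certs)
open Summit.AtomisticToContinuum.Crystallization.Theorems.ChartedPlanarOrderTubeChannelsTS (AdjacentChannelRefT AdjacentChannelRefS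
  FarChannelBelowRefT FarChannelBelowRefS)
open Summit.AtomisticToContinuum.Crystallization.Theorems.ChartedPlanarOrderStackedUniform (stackedUniform)
open Summit.AtomisticToContinuum.Crystallization.Theorems.ChartedPlanarOrderPairModulusTail (sum_Ico_sq_mul_power_le)
open Summit.AtomisticToContinuum.Crystallization.Theorems.OverbindingBudgetPeriodicCleanOrStrained (UniformlyClean)
open Summit.AtomisticToContinuum.Crystallization.Theorems.OverbindingBudgetScaleWidening (IsCleanW)
open Summit.AtomisticToContinuum.Crystallization.Theorems.ChartedPlanarOrderHeightFloor (cleanStackedWindows)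
open Summit.AtomisticToContinuum.Crystallization.Theorems.ChartedPlanarOrderLatticeSmear (tsum_modulus_le_smear norm_sq_lin)

/-! ## §4 The leaf `PairModulusTailRef (17/16) (1/40) s₀ B₂(s₀)` with the sharp budget, and the records -/

/-- monotonicity of the tail leaf in its budget. -/
theorem pairModulusTailRef_mono {Λ₁ ρ B₂ B₂' : ℝ} {s₀ : ℕ} (hB : B₂ ≤ B₂') (h : PairModulusTailRef Λ₁ ρ s₀ B₂) :
    PairModulusTailRef Λ₁ ρ s₀ B₂' := fun δ hδ a b w' hst hab ha hb hs hc hz hUC => by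
  obtain ⟨τ, hτ0, hτB, hPM⟩ := h δ hδ a b w' hst hab ha hb hs hc hz hUC
  exact ⟨τ, hτ0, fun N => (hτB N).trans hB, hPM⟩

/-- `B₂(s₀, ε) := sharpConst(73/100, 31/50 − 1/40, 1/40, 23/25, ε, s₀) / (3 (s₀ − 1)³)` — the uniform sharp tail budget. -/
def tailBudget (ε : ℝ) (s₀ : ℕ) : ℝ :=
  sharpConst (73 / 100) (31 / 50 - 1 / 40) (1 / 40) (23 / 25) ε s₀ / (3 * (((s₀ : ℕ) : ℝ) - 1) ^ 3)

/-- ★★★ THE SHARP TAIL LEAF: `PairModulusTailRef (17/16) (1/40) s₀ (tailBudget ε s₀)` for every `s₀ ≥ 2`, `ε > 0` with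
`Θ₂(119/200, 1/40, 23/25, ε, s₀) > 0` — height floor `31/50 ≤ 33a′/50` (`a′ ≥ 47/50`) from `…HeightFloor.cleanStackedWindows`. -/
theorem pairModulusTailRef_sharp {ε : ℝ} {s₀ : ℕ} (hε : 0 < ε) (hs₀ : 2 ≤ s₀)
    (hΘ : 0 < thetaSq (31 / 50 - 1 / 40) (1 / 40) (23 / 25) ε s₀) :
    PairModulusTailRef (17 / 16) (1 / 40) s₀ (tailBudget ε s₀) := by
  intro δ hδ a b w' hst hab ha hb hs hc hz hUC
  obtain ⟨ν, a', hν, hνa, hνb, ha'lo, -, -, -, -, -, -, -, hfloor, -⟩ := cleanStackedWindows hst hab ha hb hUC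
  have hw : ∀ i, (31 / 50 : ℝ) ≤ ⟪ν, incr w' i⟫ := fun i => by linarith [hfloor i]
  exact exists_tail_of_floor hst hab ha hb hUC hν hνa hνb hw (by norm_num) hε hs₀ hΘ

/-- ★ RECORD `s₀ = 9` (`ε = 3/5`): `PairModulusTailRef (17/16) (1/40) 9 (43/100)`. -/
theorem pairModulusTailRef_record₉ : PairModulusTailRef (17 / 16) (1 / 40) 9 (43 / 100) := by
  have hΘ : 0 < thetaSq (31 / 50 - 1 / 40) (1 / 40) (23 / 25) (3 / 5) 9 := by unfold thetaSq; norm_num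
  refine pairModulusTailRef_mono ?_ (pairModulusTailRef_sharp (by norm_num) (by norm_num) hΘ)
  unfold tailBudget sharpConst thetaSq
  have hπ := Real.pi_lt_d2
  have hπ0 := Real.pi_pos
  norm_num at hΘ ⊢
  nlinarith

/-- ★ RECORD `s₀ = 7` (`ε = 3/4`): `PairModulusTailRef (17/16) (1/40) 7 (6/5)`. -/
theorem pairModulusTailRef_record₇ : PairModulusTailRef (17 / 16) (1 / 40) 7 (6 / 5) := by
  have hΘ : 0 < thetaSq (31 / 50 - 1 / 40) (1 / 40) (23 / 25) (3 / 4) 7 := by unfold thetaSq; norm_num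
  refine pairModulusTailRef_mono ?_ (pairModulusTailRef_sharp (by norm_num) (by norm_num) hΘ)
  unfold tailBudget sharpConst thetaSq
  have hπ := Real.pi_lt_d2
  have hπ0 := Real.pi_pos
  norm_num at hΘ ⊢
  nlinarith

/-- ★ RECORD `s₀ = 12` (`ε = 1/2`): `PairModulusTailRef (17/16) (1/40) 12 (3/20)`. -/
theorem pairModulusTailRef_record₁₂ : PairModulusTailRef (17 / 16) (1 / 40) 12 (3 / 20) := by
  have hΘ : 0 < thetaSq (31 / 50 - 1 / 40) (1 / 40) (23 / 25) (1 / 2) 12 := by unfold thetaSq; norm_num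
  refine pairModulusTailRef_mono ?_ (pairModulusTailRef_sharp (by norm_num) (by norm_num) hΘ)
  unfold tailBudget sharpConst thetaSq
  have hπ := Real.pi_lt_d2
  have hπ0 := Real.pi_pos
  norm_num at hΘ ⊢
  nlinarith

/-- ★ NEAR-TRIANGULAR RECORD at configuration level (`s₀ = 9`, `ε = 1/2`): a height floor `73/100 ≤ 39a′/50` w.r.t. a unit normal `ν ⊥ a, b`
(the near-triangular branch of `…HeightFloor.cleanStackedWindows`) gives the tail budget `7/50` from span `9` on. -/
theorem exists_tail_record₉T {a b ν : E3} {w' : ℤ → E3} (hst : IsStacked a b w') (hab : LinearIndependent ℝ ![a, b])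
    (ha : ‖a‖ ≤ 17 / 16) (hb : ‖b‖ ≤ 17 / 16) (hUC : UniformlyClean (Layered a b w')) (hν : ‖ν‖ = 1) (hνa : ⟪ν, a⟫ = 0)
    (hνb : ⟪ν, b⟫ = 0) (hw : ∀ i, (73 / 100 : ℝ) ≤ ⟪ν, incr w' i⟫) :
    ∃ τ : ℕ → ℝ, (∀ s, 0 ≤ τ s) ∧ (∀ N : ℕ, ∑ s ∈ Finset.Ico 9 N, ((s : ℕ) : ℝ) ^ 2 * τ s ≤ 7 / 50) ∧
      IsPairModulus a b w' (1 / 40) τ := by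
  have hΘ : 0 < thetaSq (73 / 100 - 1 / 40) (1 / 40) (23 / 25) (1 / 2) 9 := by unfold thetaSq; norm_num
  obtain ⟨τ, hτ0, hτB, hPM⟩ := exists_tail_of_floor hst hab ha hb hUC hν hνa hνb hw (by norm_num) (by norm_num) (by norm_num) hΘ
  refine ⟨τ, hτ0, fun N => (hτB N).trans ?_, hPM⟩
  unfold sharpConst thetaSq
  have hπ := Real.pi_lt_d2
  have hπ0 := Real.pi_pos
  norm_num at hΘ ⊢
  nlinarith

/-! ## §5 Consumer form: slot 7c‴ of record from the two certificate leaves with the sharp tail budget -/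

/-- ★★ 7c‴ of record `TubeConvexRef (17/16) (1/40)` from CHᴬ-Ref + CHꜰ-Ref below `s₀` + the channel arithmetic with the SHARP tail budget
`tailBudget ε s₀` (cf. `…PairModulusTail.tubeConvexRef_record_of_certs`, whose budget was `tailConst/(3(s₀−1)³)`). -/
theorem tubeConvexRef_record_of_certs_sharp {lT lN lam B₁T B₁N ε : ℝ} {μT μN : ℕ → ℝ} {s₀ : ℕ}
    (hA : AdjacentChannelRef (17 / 16) (1 / 40) lT lN) (hB : FarChannelBelowRef (17 / 16) (1 / 40) μT μN s₀) (hε : 0 < ε)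
    (hs₀ : 2 ≤ s₀) (hΘ : 0 < thetaSq (31 / 50 - 1 / 40) (1 / 40) (23 / 25) ε s₀) (hμT : ∀ s, 0 ≤ μT s) (hμN : ∀ s, 0 ≤ μN s)
    (h₁T : ∑ s ∈ Finset.Ico 2 s₀, ((s : ℕ) : ℝ) ^ 2 * μT s ≤ B₁T) (h₁N : ∑ s ∈ Finset.Ico 2 s₀, ((s : ℕ) : ℝ) ^ 2 * μN s ≤ B₁N)
    (hlam : 0 < lam) (hlamT : lam + (B₁T + tailBudget ε s₀) ≤ lT) (hlamN : lam + (B₁N + tailBudget ε s₀) ≤ lN) :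
    TubeConvexRef (17 / 16) (1 / 40) :=
  tubeConvexRef_record_of_leaves hA hB (pairModulusTailRef_sharp hε hs₀ hΘ) hμT hμN h₁T h₁N hlam hlamT hlamN

/-- ★★ 7c‴ of record at `s₀ = 9` with the numerical tail budget `43/100`. -/
theorem tubeConvexRef_record_of_certs₉ {lT lN lam B₁T B₁N : ℝ} {μT μN : ℕ → ℝ}
    (hA : AdjacentChannelRef (17 / 16) (1 / 40) lT lN) (hB : FarChannelBelowRef (17 / 16) (1 / 40) μT μN 9)
    (hμT : ∀ s, 0 ≤ μT s) (hμN : ∀ s, 0 ≤ μN s)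
    (h₁T : ∑ s ∈ Finset.Ico 2 9, ((s : ℕ) : ℝ) ^ 2 * μT s ≤ B₁T) (h₁N : ∑ s ∈ Finset.Ico 2 9, ((s : ℕ) : ℝ) ^ 2 * μN s ≤ B₁N)
    (hlam : 0 < lam) (hlamT : lam + (B₁T + 43 / 100) ≤ lT) (hlamN : lam + (B₁N + 43 / 100) ≤ lN) : TubeConvexRef (17 / 16) (1 / 40) :=
  tubeConvexRef_record_of_leaves hA hB pairModulusTailRef_record₉ hμT hμN h₁T h₁N hlam hlamT hlamN

/-! ## §6 Per-branch consumer: the T/S twin leaves of `…TubeChannelsTS` with PER-BRANCH sharp tail budgets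

On the triangular branch `95/289·‖a‖² ≤ |⟪a, b⟫|` of `stackedUniform` the cell of `…HeightFloor.cleanStackedWindows` is near-triangular (the
square window `63a′/50 ≤ min ‖a ∓ b‖` would force `|⟪a, b⟫| ≤ 0.2466·a′² < 95/289·(49a′/50)²`), so the height floor is `39a′/50 ≥ 73/100` and the
tail budget is `sharpConst (73/100) (141/200) (1/40) (23/25) ε s₀ / (3(s₀−1)³)` (`≤ 7/10` at `s₀ = 6`, `≤ 7/50` at `s₀ = 9`); on the square branch the
universal floor `31/50` gives `tailBudget ε′ s₀′` (`≤ 9/4` at `s₀′ = 6`, `≤ 43/100` at `s₀′ = 9`).  Census TAG 177 margins at `(17/16, 1/40)`: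
`+2.07…+2.31` (T rows) / `+4.26…+4.5` (S rows), so `s₀ = s₀′ = 6` (four far certificates per branch) is reachable. -/

/-- ★★ CH-Ref `TubeChannelsRef (17/16) (1/40)` from the per-branch certificate leaves of `…TubeChannelsTS` with per-branch sharp tail budgets:
floor `73/100` on the triangular branch, `31/50` on the square branch. -/
theorem tubeChannelsRef_of_branch_certs_sharp {lT lN lam B₁T B₁N ε : ℝ} {μT μN : ℕ → ℝ} {s₀ : ℕ}
    (hAT : AdjacentChannelRefT (17 / 16) (1 / 40) lT lN) (hBT : FarChannelBelowRefT (17 / 16) (1 / 40) μT μN s₀) (hs₀ : 2 ≤ s₀)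
    (hε : 0 < ε) (hΘ : 0 < thetaSq (73 / 100 - 1 / 40) (1 / 40) (23 / 25) ε s₀) (hμT : ∀ s, 0 ≤ μT s) (hμN : ∀ s, 0 ≤ μN s)
    (h₁T : ∑ s ∈ Finset.Ico 2 s₀, ((s : ℕ) : ℝ) ^ 2 * μT s ≤ B₁T) (h₁N : ∑ s ∈ Finset.Ico 2 s₀, ((s : ℕ) : ℝ) ^ 2 * μN s ≤ B₁N)
    (hlam : 0 < lam)
    (hlamT : lam + (B₁T + sharpConst (73 / 100) (73 / 100 - 1 / 40) (1 / 40) (23 / 25) ε s₀ / (3 * (((s₀ : ℕ) : ℝ) - 1) ^ 3)) ≤ lT)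
    (hlamN : lam + (B₁N + sharpConst (73 / 100) (73 / 100 - 1 / 40) (1 / 40) (23 / 25) ε s₀ / (3 * (((s₀ : ℕ) : ℝ) - 1) ^ 3)) ≤ lN)
    {lT' lN' lam' B₁T' B₁N' ε' : ℝ} {μT' μN' : ℕ → ℝ} {s₀' : ℕ}
    (hAS : AdjacentChannelRefS (17 / 16) (1 / 40) lT' lN') (hBS : FarChannelBelowRefS (17 / 16) (1 / 40) μT' μN' s₀') (hs₀' : 2 ≤ s₀')
    (hε' : 0 < ε') (hΘ' : 0 < thetaSq (31 / 50 - 1 / 40) (1 / 40) (23 / 25) ε' s₀') (hμT' : ∀ s, 0 ≤ μT' s) (hμN' : ∀ s, 0 ≤ μN' s)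
    (h₁T' : ∑ s ∈ Finset.Ico 2 s₀', ((s : ℕ) : ℝ) ^ 2 * μT' s ≤ B₁T') (h₁N' : ∑ s ∈ Finset.Ico 2 s₀', ((s : ℕ) : ℝ) ^ 2 * μN' s ≤ B₁N')
    (hlam' : 0 < lam') (hlamT' : lam' + (B₁T' + tailBudget ε' s₀') ≤ lT') (hlamN' : lam' + (B₁N' + tailBudget ε' s₀') ≤ lN') :
    TubeChannelsRef (17 / 16) (1 / 40) := by
  intro δ hδ a b w' hst hab ha hb hs hc hz hUC
  obtain ⟨ν, a', hν, hνa, hνb, ha'lo, -, ⟨halo, hahi⟩, ⟨-, hbhi⟩, -, hTS', hpS, -, hfloor, hfloorT⟩ :=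
    cleanStackedWindows hst hab ha hb hUC
  obtain ⟨ν₀, -, -, -, -, -, -, -, hTS⟩ := stackedUniform (aHi := 103 / 100) (by norm_num) hδ hs hc hst ha hb
  rcases hTS with ⟨hT, -⟩ | ⟨hS, -⟩
  · -- triangular branch: the cell is near-triangular, floor `39a′/50 ≥ 73/100`
    have hmin : min ‖a - b‖ ‖a + b‖ ≤ a' * (51 / 50) := by
      rcases hTS' with h | h
      · exact h
      · exfalso
        have hp := hpS h
        have hxhi : ‖a‖ ^ 2 ≤ (a' * (51 / 50)) ^ 2 := pow_le_pow_left₀ (norm_nonneg _) hahi 2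
        have hyhi : ‖b‖ ^ 2 ≤ (a' * (51 / 50)) ^ 2 := pow_le_pow_left₀ (norm_nonneg _) hbhi 2
        have hxlo : (a' * (49 / 50)) ^ 2 ≤ ‖a‖ ^ 2 := pow_le_pow_left₀ (by linarith) halo 2
        nlinarith [mul_pos (by linarith : (0 : ℝ) < a') (by linarith : (0 : ℝ) < a')]
    have hw : ∀ i, (73 / 100 : ℝ) ≤ ⟪ν, incr w' i⟫ := fun i => by linarith [hfloorT hmin i]
    obtain ⟨τ, hτ0, hτB, hPM⟩ := exists_tail_of_floor hst hab ha hb hUC hν hνa hνb hw (by norm_num) hε hs₀ hΘ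
    exact tubeChannelData_of_certs hν (hAT δ hδ a b w' hst hab ha hb hs hc hz hUC hT ν hν hνa hνb)
      (hBT δ hδ a b w' hst hab ha hb hs hc hz hUC hT ν hν hνa hνb) hPM hμT hμN hτ0 h₁T h₁N hτB hlam hlamT hlamN
  · -- square branch: the universal floor `33a′/50 ≥ 31/50`
    have hw : ∀ i, (31 / 50 : ℝ) ≤ ⟪ν, incr w' i⟫ := fun i => by linarith [hfloor i]
    obtain ⟨τ, hτ0, hτB, hPM⟩ := exists_tail_of_floor hst hab ha hb hUC hν hνa hνb hw (by norm_num) hε' hs₀' hΘ'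
    exact tubeChannelData_of_certs hν (hAS δ hδ a b w' hst hab ha hb hs hc hz hUC hS ν hν hνa hνb)
      (hBS δ hδ a b w' hst hab ha hb hs hc hz hUC hS ν hν hνa hνb) hPM hμT' hμN' hτ0 h₁T' h₁N' hτB hlam' hlamT' hlamN'

/-- ★★ 7c‴ of record `TubeConvexRef (17/16) (1/40)` from the per-branch certificate leaves with per-branch sharp tail budgets. -/
theorem tubeConvexRef_record_of_branch_certs_sharp {lT lN lam B₁T B₁N ε : ℝ} {μT μN : ℕ → ℝ} {s₀ : ℕ}
    (hAT : AdjacentChannelRefT (17 / 16) (1 / 40) lT lN) (hBT : FarChannelBelowRefT (17 / 16) (1 / 40) μT μN s₀) (hs₀ : 2 ≤ s₀)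
    (hε : 0 < ε) (hΘ : 0 < thetaSq (73 / 100 - 1 / 40) (1 / 40) (23 / 25) ε s₀) (hμT : ∀ s, 0 ≤ μT s) (hμN : ∀ s, 0 ≤ μN s)
    (h₁T : ∑ s ∈ Finset.Ico 2 s₀, ((s : ℕ) : ℝ) ^ 2 * μT s ≤ B₁T) (h₁N : ∑ s ∈ Finset.Ico 2 s₀, ((s : ℕ) : ℝ) ^ 2 * μN s ≤ B₁N)
    (hlam : 0 < lam)
    (hlamT : lam + (B₁T + sharpConst (73 / 100) (73 / 100 - 1 / 40) (1 / 40) (23 / 25) ε s₀ / (3 * (((s₀ : ℕ) : ℝ) - 1) ^ 3)) ≤ lT)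
    (hlamN : lam + (B₁N + sharpConst (73 / 100) (73 / 100 - 1 / 40) (1 / 40) (23 / 25) ε s₀ / (3 * (((s₀ : ℕ) : ℝ) - 1) ^ 3)) ≤ lN)
    {lT' lN' lam' B₁T' B₁N' ε' : ℝ} {μT' μN' : ℕ → ℝ} {s₀' : ℕ}
    (hAS : AdjacentChannelRefS (17 / 16) (1 / 40) lT' lN') (hBS : FarChannelBelowRefS (17 / 16) (1 / 40) μT' μN' s₀') (hs₀' : 2 ≤ s₀')
    (hε' : 0 < ε') (hΘ' : 0 < thetaSq (31 / 50 - 1 / 40) (1 / 40) (23 / 25) ε' s₀') (hμT' : ∀ s, 0 ≤ μT' s) (hμN' : ∀ s, 0 ≤ μN' s)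
    (h₁T' : ∑ s ∈ Finset.Ico 2 s₀', ((s : ℕ) : ℝ) ^ 2 * μT' s ≤ B₁T') (h₁N' : ∑ s ∈ Finset.Ico 2 s₀', ((s : ℕ) : ℝ) ^ 2 * μN' s ≤ B₁N')
    (hlam' : 0 < lam') (hlamT' : lam' + (B₁T' + tailBudget ε' s₀') ≤ lT') (hlamN' : lam' + (B₁N' + tailBudget ε' s₀') ≤ lN') :
    TubeConvexRef (17 / 16) (1 / 40) :=
  tubeConvexRef_record_of_channels (tubeChannelsRef_of_branch_certs_sharp hAT hBT hs₀ hε hΘ hμT hμN h₁T h₁N hlam hlamT hlamN hAS hBS hs₀'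
    hε' hΘ' hμT' hμN' h₁T' h₁N' hlam' hlamT' hlamN')

/-- ★★★ 7c‴ of record at the census' recommended `s₀ = s₀′ = 6` (four far certificates `s = 2 … 5` per branch) with the NUMERICAL per-branch tail
budgets `7/10` (triangular branch, `ε = 7/10`) and `9/4` (square branch, `ε′ = 17/20`); census TAG 177 margins `≥ 2.07` (T) / `≥ 4.26` (S). -/
theorem tubeConvexRef_record_of_branch_certs₆ {lT lN lam B₁T B₁N : ℝ} {μT μN : ℕ → ℝ}
    (hAT : AdjacentChannelRefT (17 / 16) (1 / 40) lT lN) (hBT : FarChannelBelowRefT (17 / 16) (1 / 40) μT μN 6)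
    (hμT : ∀ s, 0 ≤ μT s) (hμN : ∀ s, 0 ≤ μN s)
    (h₁T : ∑ s ∈ Finset.Ico 2 6, ((s : ℕ) : ℝ) ^ 2 * μT s ≤ B₁T) (h₁N : ∑ s ∈ Finset.Ico 2 6, ((s : ℕ) : ℝ) ^ 2 * μN s ≤ B₁N)
    (hlam : 0 < lam) (hlamT : lam + (B₁T + 7 / 10) ≤ lT) (hlamN : lam + (B₁N + 7 / 10) ≤ lN)
    {lT' lN' lam' B₁T' B₁N' : ℝ} {μT' μN' : ℕ → ℝ}
    (hAS : AdjacentChannelRefS (17 / 16) (1 / 40) lT' lN') (hBS : FarChannelBelowRefS (17 / 16) (1 / 40) μT' μN' 6)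
    (hμT' : ∀ s, 0 ≤ μT' s) (hμN' : ∀ s, 0 ≤ μN' s)
    (h₁T' : ∑ s ∈ Finset.Ico 2 6, ((s : ℕ) : ℝ) ^ 2 * μT' s ≤ B₁T') (h₁N' : ∑ s ∈ Finset.Ico 2 6, ((s : ℕ) : ℝ) ^ 2 * μN' s ≤ B₁N')
    (hlam' : 0 < lam') (hlamT' : lam' + (B₁T' + 9 / 4) ≤ lT') (hlamN' : lam' + (B₁N' + 9 / 4) ≤ lN') :
    TubeConvexRef (17 / 16) (1 / 40) := by
  have hΘ : 0 < thetaSq (73 / 100 - 1 / 40) (1 / 40) (23 / 25) (7 / 10) 6 := by unfold thetaSq; norm_num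
  have hΘ' : 0 < thetaSq (31 / 50 - 1 / 40) (1 / 40) (23 / 25) (17 / 20) 6 := by unfold thetaSq; norm_num
  have hπ := Real.pi_lt_d2
  have hπ0 := Real.pi_pos
  have hbT : sharpConst (73 / 100) (73 / 100 - 1 / 40) (1 / 40) (23 / 25) (7 / 10) 6 / (3 * (((6 : ℕ) : ℝ) - 1) ^ 3) ≤ 7 / 10 := by
    unfold sharpConst thetaSq
    norm_num
    nlinarith
  have hbS : tailBudget (17 / 20) 6 ≤ 9 / 4 := by
    unfold tailBudget sharpConst thetaSq
    norm_num
    nlinarith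
  exact tubeConvexRef_record_of_branch_certs_sharp hAT hBT (by norm_num) (by norm_num) hΘ hμT hμN h₁T h₁N hlam (by linarith) (by linarith)
    hAS hBS (by norm_num) (by norm_num) hΘ' hμT' hμN' h₁T' h₁N' hlam' (by linarith) (by linarith)

end Summit.AtomisticToContinuum.Crystallization.Theorems.ChartedPlanarOrderPairModulusSharp
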